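import Literature.RingTheory.FittingIdeal.Etale
import Mathlib.RingTheory.LocalRing.Length
import Mathlib.RingTheory.TensorProduct.Quotient
import Mathlib.RingTheory.Unramified.LocalRing
import HarnessLib

/-!
# The length of the singular scheme is invariant under étale local maps (Stacks 02M1 with 07ZA)

Topic: `Literature/RingTheory/FittingIdeal`. The invariant "length of `R/Fitt_k(Ω_{R/A})`" of a
local `A`-algebra `R` — for `k = 1` and `R = 𝒪_{X,x}` the length of de Jong 1996, 2.21's
singular scheme `Sing(f) = V(Fitt₁ Ω_{X/S})` at `x`, i.e. the thickness `n_T` of 3.4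
(`Scheme.Hom.nodeThickness`, `Literature/AlgebraicGeometry/Resolution`) — does not change under
an étale local homomorphism `R → R'` (the local ring of an étale neighbourhood of `x`). PROVED:

* `Module.length_quotient_map_eq_of_flat_of_map_maximalIdeal` — **Stacks 02M1 in the unramified
  case**: for a flat local homomorphism of local rings `R → R'` with `𝔪_R R' = 𝔪_{R'}` and an
  ideal `J ⊆ R`, `ℓ_{R'}(R'/J R') = ℓ_R(R/J)` (Mathlib's `IsLocalRing.length_baseChange`:
  `ℓ_{R'}(R' ⊗ N) = ℓ_R(N) · ℓ_{R'}(R'/𝔪_R R')`, and `ℓ_{R'}(κ(R')) = 1`);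
* `Module.length_quotient_fittingIdeal_kaehlerDifferential_eq_of_formallyEtale` — for `R → R'`
  moreover formally étale (so `Fitt_k(Ω_{R'/A}) = Fitt_k(Ω_{R/A}) R'`,
  `Module.fittingIdeal_kaehlerDifferential_of_formallyEtale`, `Etale.lean`):
  `ℓ_{R'}(R'/Fitt_k Ω_{R'/A}) = ℓ_R(R/Fitt_k Ω_{R/A})`; and the variant
  `…_of_formallyEtale_of_essFiniteType` where `𝔪_R R' = 𝔪_{R'}` is supplied by Mathlib's
  `Algebra.FormallyUnramified.map_maximalIdeal` (Stacks 00UW) for `R'` essentially of finite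
  type over `R`.

So de Jong's `n_T` may be computed on any étale neighbourhood — in particular on the étale-local
model `A'[u, v]/(Q - h)` of 2.23/3.3 (`AlterationsNodalModelThickness.lean` in
`Literature/AlgebraicGeometry/Resolution`), once such a neighbourhood is produced.

## Sources

* The Stacks Project, Tag 02M1 (length and flat local base change), Tag 00UW (unramified local
  homomorphisms), Tag 07ZA (3). [StacksProject]
* D. Eisenbud, *Commutative Algebra with a View Toward Algebraic Geometry*, GTM 150 (1995),
  Cor. 20.5. [Eisenbud1995]
-/

namespace Literature.RingTheory.FittingIdeal

universe u v w

open TensorProduct IsLocalRing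

/-- **Stacks 02M1, unramified case: `ℓ_{R'}(R'/JR') = ℓ_R(R/J)`** for a flat local homomorphism
of local rings `R → R'` with `𝔪_R R' = 𝔪_{R'}` and any ideal `J ⊆ R`:
`R'/JR' = R' ⊗_R R/J`, `ℓ_{R'}(R' ⊗ N) = ℓ_R(N) · ℓ_{R'}(R'/𝔪_R R')`
(`IsLocalRing.length_baseChange`) and `R'/𝔪_R R' = κ(R')` has length `1`.
[cite: StacksProject, Tag 02M1] -/
theorem Module.length_quotient_map_eq_of_flat_of_map_maximalIdeal {R : Type u} {R' : Type v}
    [CommRing R] [CommRing R'] [IsLocalRing R] [IsLocalRing R'] [Algebra R R']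
    [IsLocalHom (algebraMap R R')] [Module.Flat R R']
    (hunr : (maximalIdeal R).map (algebraMap R R') = maximalIdeal R') (J : Ideal R) :
    Module.length R' (R' ⧸ J.map (algebraMap R R')) = Module.length R (R ⧸ J) := by
  rw [(Algebra.TensorProduct.quotIdealMapEquivTensorQuot R' J).toLinearEquiv.length_eq,
    IsLocalRing.length_baseChange R R' (R ⧸ J), hunr]
  haveI : IsSimpleModule R' (R' ⧸ maximalIdeal R') :=
    isSimpleModule_iff_quot_maximal.2
      ⟨maximalIdeal R', IsLocalRing.maximalIdeal.isMaximal R', ⟨LinearEquiv.refl _ _⟩⟩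
  rw [Module.length_eq_one (R := R') (M := R' ⧸ maximalIdeal R'), mul_one]

/-- **The length of the singular scheme is invariant under étale local homomorphisms.** Let
`A` be a ring, `R → R'` a local homomorphism of local `A`-algebras which is flat, formally étale
and unramified in the sense `𝔪_R R' = 𝔪_{R'}`, and assume `Ω_{R/A}` finite. Then for every `k`,
`ℓ_{R'}(R'/Fitt_k(Ω_{R'/A})) = ℓ_R(R/Fitt_k(Ω_{R/A}))`: `Fitt_k(Ω_{R'/A}) = Fitt_k(Ω_{R/A}) R'`
(`Module.fittingIdeal_kaehlerDifferential_of_formallyEtale`) and Stacks 02M1. For `k = 1` and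
the local rings of a morphism of schemes at a point and at a point of an étale neighbourhood,
this is the invariance of de Jong 1996, 3.4's `n_T` under étale localisation.
[cite: StacksProject, Tag 02M1] -/
theorem Module.length_quotient_fittingIdeal_kaehlerDifferential_eq_of_formallyEtale
    {A : Type u} {R : Type v} {R' : Type w} [CommRing A] [CommRing R] [CommRing R']
    [IsLocalRing R] [IsLocalRing R'] [Algebra A R] [Algebra A R'] [Algebra R R']
    [IsScalarTower A R R'] [IsLocalHom (algebraMap R R')] [Module.Flat R R']
    [Algebra.FormallyEtale R R'] (hunr : (maximalIdeal R).map (algebraMap R R') = maximalIdeal R')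
    [Module.Finite R (Ω[R⁄A])] (k : ℕ) :
    Module.length R' (R' ⧸ Module.fittingIdeal R' (Ω[R'⁄A]) k) =
      Module.length R (R ⧸ Module.fittingIdeal R (Ω[R⁄A]) k) := by
  rw [Module.fittingIdeal_kaehlerDifferential_of_formallyEtale (B := R) (B' := R') k]
  exact Module.length_quotient_map_eq_of_flat_of_map_maximalIdeal hunr _

/-- The same with `𝔪_R R' = 𝔪_{R'}` supplied by Stacks 00UW
(`Algebra.FormallyUnramified.map_maximalIdeal`): a formally unramified local homomorphism
essentially of finite type is unramified. [cite: StacksProject, Tag 02M1] -/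
theorem Module.length_quotient_fittingIdeal_kaehlerDifferential_eq_of_formallyEtale_of_essFiniteType
    {A : Type u} {R : Type v} {R' : Type w} [CommRing A] [CommRing R] [CommRing R']
    [IsLocalRing R] [IsLocalRing R'] [Algebra A R] [Algebra A R'] [Algebra R R']
    [IsScalarTower A R R'] [IsLocalHom (algebraMap R R')] [Module.Flat R R']
    [Algebra.FormallyEtale R R'] [Algebra.EssFiniteType R R'] [Module.Finite R (Ω[R⁄A])] (k : ℕ) :
    Module.length R' (R' ⧸ Module.fittingIdeal R' (Ω[R'⁄A]) k) =
      Module.length R (R ⧸ Module.fittingIdeal R (Ω[R⁄A]) k) :=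
  Module.length_quotient_fittingIdeal_kaehlerDifferential_eq_of_formallyEtale
    (Algebra.FormallyUnramified.map_maximalIdeal) k

end Literature.RingTheory.FittingIdeal
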